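import Summits.QuantumFields.BalabanUV.Beta.GAN24.CapacitanceClosedForm

/-!
# `BalabanUV.Beta.GAN24.CapacitanceClosedFormGauge` — binder row G-an2-4 / (CONV-C), road P1-fibre, crux A4 of `SKELETON-P1.md`:
# the GAUGE-CONSTANT CHANNEL of the closed-form capacitance inverse — the exact `m = 0` identity `σ⁰·h⁰ = 2` and the cancellation form of `(Cap⁻¹)_cc`

NOT IN PRINT; OUR PROOF ATTEMPT.  HONEST FRAMING (cell contract, verbatim): «discharging `BetaPertH` makes Bałaban's UV stability UNCONDITIONAL — a real
constructive-QFT result; it is NOT the continuum limit and NOT the Clay problem.»  HONEST DEPENDENCY (verbatim): «continuum YM on T⁴ ⇐ BetaPertH ∧ nine spine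
estimates (0/9 proved); BetaPertH ⇐ (D1) ∧ (D4) ∧ CAP+tail; G-an2-4 gates asym, D1 and NE2/3/4.»  [folklore] finite-dimensional algebra over `ℂ` plus the
triangle inequality (no cited fact, no wall binder, no `def … : Prop` hypothesis).  NOT summit progress; nothing of (CONV-C)'s K-slot is discharged here.

## What is proved
`GAN24/CapacitanceClosedForm` (p201156) inverts the capacitance matrix `[[diag(a) − (σ/2)δδ'ᵀ, σδ],[σδ'ᵀ, 0]]` of the per-fibre arrow system explicitly; its
`c`-`c` block is `invcc = 1/(2σ) − 1/(σ²h)`, `h = hSum a δ δ' = Σ_κ δ_κδ'_κ/a_κ`, and the NO-CANCELLATION bound `‖invcc‖ ≤ ς/2 + ς²η` is of pole order when fed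
through the `m = 0` gauge column of the field block (journal erratum l.2746).  THIS FILE records the cancellation that removes that pole:
* `invcc_eq_cancel`: `invcc a δ δ' σ = (σ·h − 2)/(2σ²h)` (for `σ ≠ 0`, `h ≠ 0`), and `norm_invcc_le_of_defect`: `‖σ·h − 2‖ ≤ d`, `‖σ⁻¹‖ ≤ ς`, `‖h⁻¹‖ ≤ η`
  ⇒ `‖invcc‖ ≤ d·ς²·η/2`;
* **`sigma0_mul_hSum0_eq_two`** — THE ONE-ALIAS IDENTITY: for a single alias (the `m = 0` block: symbols `∂, ∂♭` with `∂♭·∂ = L ≠ 0`, weights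
  `wQ, wE : Fin D → ℂ`, `wM, wG : ℂ`, all non-zero) satisfying the telescoping identities (T1) `wQ_κ ∂_κ = wM δ_κ`, (T2) `∂♭_κ wE_κ = wG δ'_κ`, the partial
  sums `a⁰_κ := wQ_κ wE_κ/(2L)`, `σ⁰ := wM wG/L²` satisfy `σ⁰ · hSum a⁰ δ δ' = 2` EXACTLY (because `δ_κδ'_κ/a⁰_κ = 2L ∂_κ∂♭_κ/(wM wG)` and `Σ_κ ∂_κ∂♭_κ = L`);
* `defect_split`: with `σ⁰·h⁰ = 2`, `σ·h − 2 = σ⁰·(h − h⁰) + (σ − σ⁰)·h`, and `hSum_sub_hSum`: `h − h⁰ = −Σ_κ δ_κδ'_κ (a_κ − a⁰_κ)/(a_κ a⁰_κ)` — so the defect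
  `σh − 2`, hence `(Cap⁻¹)_cc`, is carried ENTIRELY by the `m ≠ 0` shares `a − a⁰`, `σ − σ⁰` of the scalar alias sums (numerically `(σh − 2)/|p|⁴ ∈
  [−0.0035, −0.0001]` for `D = 2,3,4`, `N = 3…8`, i.e. `(Cap⁻¹)_cc = O(|p|⁸/N^{D+4})` = `SKELETON-P1.md` A4′(iii) `−ε_∥|p|⁶`, `ε_∥ = O(p²)`; the N-uniform
  BOUNDS of the shares are leaf P1-L08c's, not proved here);
* `norm_defect_le`: the resulting triangle-inequality bound `‖σh − 2‖ ≤ s₀·D·ε²·α'·α·α₀ + s'·‖h‖`-type estimate from entrywise bounds of the shares.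
-/

open Finset
open scoped BigOperators

namespace Summit.QuantumFields.BalabanUV.Beta.GAN24.CapacitanceClosedFormGauge

open FibreBlockSolve (dot)
open CapacitanceClosedForm (hSum invcc)

variable {D : ℕ}

/-! ## §1 The cancellation form of `(Cap⁻¹)_cc` -/

/-- [folklore] `(Cap⁻¹)_cc = 1/(2σ) − 1/(σ²h) = (σh − 2)/(2σ²h)`. -/
theorem invcc_eq_cancel (a δ δ' : Fin D → ℂ) {σ : ℂ} (hσ : σ ≠ 0) (hh : hSum a δ δ' ≠ 0) :
    invcc a δ δ' σ = (σ * hSum a δ δ' - 2) / (2 * σ ^ 2 * hSum a δ δ') := by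
  unfold invcc
  rw [div_sub_div _ _ (mul_ne_zero two_ne_zero hσ) (mul_ne_zero (pow_ne_zero 2 hσ) hh), div_eq_div_iff
    (mul_ne_zero (mul_ne_zero two_ne_zero hσ) (mul_ne_zero (pow_ne_zero 2 hσ) hh))
    (mul_ne_zero (mul_ne_zero two_ne_zero (pow_ne_zero 2 hσ)) hh)]
  ring

/-- [folklore] **SMALL DEFECT ⇒ SMALL `(Cap⁻¹)_cc`**: `‖σh − 2‖ ≤ d`, `‖σ⁻¹‖ ≤ ς`, `‖h⁻¹‖ ≤ η` ⇒ `‖(Cap⁻¹)_cc‖ ≤ d ς² η / 2`. -/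
theorem norm_invcc_le_of_defect (a δ δ' : Fin D → ℂ) {σ : ℂ} (hσ : σ ≠ 0) (hh : hSum a δ δ' ≠ 0) {d ς η : ℝ}
    (hd : ‖σ * hSum a δ δ' - 2‖ ≤ d) (hς : ‖σ⁻¹‖ ≤ ς) (hη : ‖(hSum a δ δ')⁻¹‖ ≤ η) :
    ‖invcc a δ δ' σ‖ ≤ d * ς ^ 2 * η / 2 := by
  have hd0 : 0 ≤ d := le_trans (norm_nonneg _) hd
  have hς0 : 0 ≤ ς := le_trans (norm_nonneg _) hς
  have e : invcc a δ δ' σ = (σ * hSum a δ δ' - 2) * σ⁻¹ * σ⁻¹ * (hSum a δ δ')⁻¹ * 2⁻¹ := by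
    rw [invcc_eq_cancel a δ δ' hσ hh, div_eq_mul_inv, mul_inv, mul_inv, sq, mul_inv]
    ring
  have e2 : ‖(2 : ℂ)⁻¹‖ = 2⁻¹ := by simp
  have s2 : ‖σ * hSum a δ δ' - 2‖ * ‖σ⁻¹‖ ≤ d * ς := mul_le_mul hd hς (norm_nonneg _) hd0
  have s3 : ‖σ * hSum a δ δ' - 2‖ * ‖σ⁻¹‖ * ‖σ⁻¹‖ ≤ d * ς * ς := mul_le_mul s2 hς (norm_nonneg _) (mul_nonneg hd0 hς0)
  have s4 : ‖σ * hSum a δ δ' - 2‖ * ‖σ⁻¹‖ * ‖σ⁻¹‖ * ‖(hSum a δ δ')⁻¹‖ ≤ d * ς * ς * η :=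
    mul_le_mul s3 hη (norm_nonneg _) (mul_nonneg (mul_nonneg hd0 hς0) hς0)
  calc ‖invcc a δ δ' σ‖ = ‖σ * hSum a δ δ' - 2‖ * ‖σ⁻¹‖ * ‖σ⁻¹‖ * ‖(hSum a δ δ')⁻¹‖ * 2⁻¹ := by
        rw [e]; simp only [norm_mul, e2]
    _ ≤ d * ς * ς * η * 2⁻¹ := mul_le_mul_of_nonneg_right s4 (by norm_num)
    _ = d * ς ^ 2 * η / 2 := by ring

/-! ## §2 The one-alias identity `σ⁰ · h⁰ = 2` (the `m = 0` block alone) -/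

/-- [folklore] Under (T1) with `wM ≠ 0`: `δ_κ = wQ_κ ∂_κ / wM`. -/
theorem delta_eq_of_T1 (dd wQ δ : Fin D → ℂ) {wM : ℂ} (hM : wM ≠ 0) (hT1 : ∀ κ, wQ κ * dd κ = wM * δ κ) (κ : Fin D) :
    δ κ = wQ κ * dd κ / wM := by
  rw [eq_div_iff hM]
  linear_combination (-1 : ℂ) * hT1 κ

/-- [folklore] Under (T2) with `wG ≠ 0`: `δ'_κ = ∂♭_κ wE_κ / wG`. -/
theorem delta'_eq_of_T2 (db wE δ' : Fin D → ℂ) {wG : ℂ} (hG : wG ≠ 0) (hT2 : ∀ κ, db κ * wE κ = wG * δ' κ) (κ : Fin D) :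
    δ' κ = db κ * wE κ / wG := by
  rw [eq_div_iff hG]
  linear_combination (-1 : ℂ) * hT2 κ

/-- [folklore] One-alias summand identity: `δ_κ δ'_κ / (wQ_κ wE_κ/(2L)) = 2L ∂_κ ∂♭_κ/(wM wG)`. -/
theorem summand_one_alias (dd db wQ wE δ δ' : Fin D → ℂ) {L wM wG : ℂ} (hL : L ≠ 0) (hM : wM ≠ 0) (hG : wG ≠ 0)
    (hQ : ∀ κ, wQ κ ≠ 0) (hE : ∀ κ, wE κ ≠ 0) (hT1 : ∀ κ, wQ κ * dd κ = wM * δ κ) (hT2 : ∀ κ, db κ * wE κ = wG * δ' κ)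
    (κ : Fin D) :
    δ κ * δ' κ / (wQ κ * wE κ / (2 * L)) = 2 * L * (dd κ * db κ) / (wM * wG) := by
  rw [delta_eq_of_T1 dd wQ δ hM hT1 κ, delta'_eq_of_T2 db wE δ' hG hT2 κ]
  have hQκ := hQ κ
  have hEκ := hE κ
  field_simp

/-- [folklore] **THE ONE-ALIAS IDENTITY `σ⁰ · h⁰ = 2`**: for one alias block with `∂♭·∂ = L ≠ 0`, non-zero weights and the telescoping identities,
`(wM wG / L²) · hSum (κ ↦ wQ_κ wE_κ/(2L)) δ δ' = 2` — the `m = 0` parts of `σ` and `h` cancel the `c`-`c` block EXACTLY. -/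
theorem sigma0_mul_hSum0_eq_two (dd db wQ wE δ δ' : Fin D → ℂ) {L wM wG : ℂ} (hL : L ≠ 0) (hLdef : dot db dd = L) (hM : wM ≠ 0)
    (hG : wG ≠ 0) (hQ : ∀ κ, wQ κ ≠ 0) (hE : ∀ κ, wE κ ≠ 0) (hT1 : ∀ κ, wQ κ * dd κ = wM * δ κ)
    (hT2 : ∀ κ, db κ * wE κ = wG * δ' κ) :
    wM * wG / L ^ 2 * hSum (fun κ => wQ κ * wE κ / (2 * L)) δ δ' = 2 := by
  have hsum : hSum (fun κ => wQ κ * wE κ / (2 * L)) δ δ' = 2 * L * L / (wM * wG) := by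
    unfold hSum
    simp only [summand_one_alias dd db wQ wE δ δ' hL hM hG hQ hE hT1 hT2]
    rw [← Finset.sum_div, ← Finset.mul_sum]
    congr 2
    rw [← hLdef]
    unfold dot
    exact Finset.sum_congr rfl fun κ _ => by ring
  rw [hsum]
  field_simp

/-! ## §3 The defect `σh − 2` lives on the `m ≠ 0` shares -/

/-- [folklore] **DEFECT SPLIT**: if `σ⁰ h⁰ = 2` then `σ h − 2 = σ⁰ (h − h⁰) + (σ − σ⁰) h`. -/
theorem defect_split {σ σ0 h h0 : ℂ} (h2 : σ0 * h0 = 2) : σ * h - 2 = σ0 * (h - h0) + (σ - σ0) * h := by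
  linear_combination h2

/-- [folklore] `h − h⁰ = −Σ_κ δ_κ δ'_κ (a_κ − a⁰_κ)/(a_κ a⁰_κ)` for `a_κ, a⁰_κ ≠ 0`. -/
theorem hSum_sub_hSum (a a0 δ δ' : Fin D → ℂ) (ha : ∀ κ, a κ ≠ 0) (ha0 : ∀ κ, a0 κ ≠ 0) :
    hSum a δ δ' - hSum a0 δ δ' = -∑ κ, δ κ * δ' κ * (a κ - a0 κ) / (a κ * a0 κ) := by
  unfold hSum
  rw [← Finset.sum_sub_distrib, ← Finset.sum_neg_distrib]
  refine Finset.sum_congr rfl fun κ _ => ?_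
  have h1 := ha κ
  have h2 := ha0 κ
  field_simp
  ring

/-- [folklore] **ENTRYWISE DEFECT BOUND**: from `σ⁰h⁰ = 2`, `‖δ_κ‖,‖δ'_κ‖ ≤ ε`, `‖a_κ⁻¹‖ ≤ α`, `‖(a⁰_κ)⁻¹‖ ≤ α₀`, `‖a_κ − a⁰_κ‖ ≤ t` (the `m ≠ 0` share of
the diagonal sums), `‖σ⁰‖ ≤ s₀`, `‖σ − σ⁰‖ ≤ s` (the `m ≠ 0` share of the border sum) and `‖h‖ ≤ H`:
`‖σh − 2‖ ≤ s₀·(D·ε²·t·α·α₀) + s·H`. -/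
theorem norm_defect_le (a a0 δ δ' : Fin D → ℂ) {σ σ0 : ℂ} (ha : ∀ κ, a κ ≠ 0) (ha0 : ∀ κ, a0 κ ≠ 0)
    (h2 : σ0 * hSum a0 δ δ' = 2) {ε α α₀ t s₀ s H : ℝ} (hε : ∀ κ, ‖δ κ‖ ≤ ε) (hε' : ∀ κ, ‖δ' κ‖ ≤ ε)
    (hα : ∀ κ, ‖(a κ)⁻¹‖ ≤ α) (hα₀ : ∀ κ, ‖(a0 κ)⁻¹‖ ≤ α₀) (ht : ∀ κ, ‖a κ - a0 κ‖ ≤ t) (hs₀ : ‖σ0‖ ≤ s₀)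
    (hs : ‖σ - σ0‖ ≤ s) (hH : ‖hSum a δ δ'‖ ≤ H) :
    ‖σ * hSum a δ δ' - 2‖ ≤ s₀ * (D * (ε ^ 2 * t * α * α₀)) + s * H := by
  rw [defect_split h2, hSum_sub_hSum a a0 δ δ' ha ha0]
  have hD : ‖-∑ κ, δ κ * δ' κ * (a κ - a0 κ) / (a κ * a0 κ)‖ ≤ D * (ε ^ 2 * t * α * α₀) := by
    rw [norm_neg]
    have hterm : ∀ κ ∈ (Finset.univ : Finset (Fin D)), ‖δ κ * δ' κ * (a κ - a0 κ) / (a κ * a0 κ)‖ ≤ ε ^ 2 * t * α * α₀ := by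
      intro κ _
      have hε0 : 0 ≤ ε := le_trans (norm_nonneg _) (hε κ)
      have ht0 : 0 ≤ t := le_trans (norm_nonneg _) (ht κ)
      have hα0' : 0 ≤ α := le_trans (norm_nonneg _) (hα κ)
      have e : δ κ * δ' κ * (a κ - a0 κ) / (a κ * a0 κ) = δ κ * δ' κ * (a κ - a0 κ) * (a κ)⁻¹ * (a0 κ)⁻¹ := by
        rw [div_eq_mul_inv, mul_inv]; ring
      have s2 : ‖δ κ‖ * ‖δ' κ‖ ≤ ε * ε := mul_le_mul (hε κ) (hε' κ) (norm_nonneg _) hε0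
      have s3 : ‖δ κ‖ * ‖δ' κ‖ * ‖a κ - a0 κ‖ ≤ ε * ε * t := mul_le_mul s2 (ht κ) (norm_nonneg _) (mul_nonneg hε0 hε0)
      have s4 : ‖δ κ‖ * ‖δ' κ‖ * ‖a κ - a0 κ‖ * ‖(a κ)⁻¹‖ ≤ ε * ε * t * α :=
        mul_le_mul s3 (hα κ) (norm_nonneg _) (mul_nonneg (mul_nonneg hε0 hε0) ht0)
      have s5 : ‖δ κ‖ * ‖δ' κ‖ * ‖a κ - a0 κ‖ * ‖(a κ)⁻¹‖ * ‖(a0 κ)⁻¹‖ ≤ ε * ε * t * α * α₀ :=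
        mul_le_mul s4 (hα₀ κ) (norm_nonneg _) (mul_nonneg (mul_nonneg (mul_nonneg hε0 hε0) ht0) hα0')
      calc ‖δ κ * δ' κ * (a κ - a0 κ) / (a κ * a0 κ)‖
          = ‖δ κ‖ * ‖δ' κ‖ * ‖a κ - a0 κ‖ * ‖(a κ)⁻¹‖ * ‖(a0 κ)⁻¹‖ := by rw [e]; simp only [norm_mul]
        _ ≤ ε * ε * t * α * α₀ := s5
        _ = ε ^ 2 * t * α * α₀ := by ring
    calc ‖∑ κ, δ κ * δ' κ * (a κ - a0 κ) / (a κ * a0 κ)‖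
        ≤ ∑ κ : Fin D, ε ^ 2 * t * α * α₀ := norm_sum_le_of_le _ hterm
      _ = D * (ε ^ 2 * t * α * α₀) := by simp
  have hs00 : 0 ≤ s₀ := le_trans (norm_nonneg _) hs₀
  have hs0 : 0 ≤ s := le_trans (norm_nonneg _) hs
  calc ‖σ0 * -∑ κ, δ κ * δ' κ * (a κ - a0 κ) / (a κ * a0 κ) + (σ - σ0) * hSum a δ δ'‖
      ≤ ‖σ0 * -∑ κ, δ κ * δ' κ * (a κ - a0 κ) / (a κ * a0 κ)‖ + ‖(σ - σ0) * hSum a δ δ'‖ := norm_add_le _ _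
    _ = ‖σ0‖ * ‖-∑ κ, δ κ * δ' κ * (a κ - a0 κ) / (a κ * a0 κ)‖ + ‖σ - σ0‖ * ‖hSum a δ δ'‖ := by rw [norm_mul, norm_mul]
    _ ≤ s₀ * (D * (ε ^ 2 * t * α * α₀)) + s * H := by
        apply add_le_add
        · exact mul_le_mul hs₀ hD (norm_nonneg _) hs00
        · exact mul_le_mul hs hH (norm_nonneg _) hs0

end Summit.QuantumFields.BalabanUV.Beta.GAN24.CapacitanceClosedFormGauge
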